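import Mathlib
import HarnessLib
import Summits.Ventures.LatticeQCDFlow.Scoring.BatchMeansSigmaHat
import Summits.Ventures.LatticeQCDFlow.Scoring.ChainMartingaleFourthMoment

/-!
# The batch-means estimator at the CLT scale, decomposed PATHWISE: `√a (σ̂²_{a,b} − m)` equals the
# centred squared block martingales `(Σ_j (M_{bj,b}² − Σ_i q(X_{bj+i})))/(√a b)` plus seven
# remainder terms (compensator fluctuation, start/end boundary terms, squared boundary, centring)

HONEST FRAMING: exact (Metropolis-corrected) sampling algorithms for lattice gauge theory;
figures of merit are autocorrelation/cost numbers at stated couplings and volumes; no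
continuum-physics claim.

Venture `LatticeQCDFlow` (cell pub-lqcd), topic `Scoring`; FANOUT row 4 (`s0-u1-b`, GEN-30).
NEW WORK of the cell, not a published result; no definition is introduced; nothing is cited as a
fact.  Pure algebra, no probability: with `c` a centring constant, `h` a solution of the Poisson
equation `h − kop κ h = f − c` (so that the centred batch sum telescopes,
`Σ_{i<b} (f(x_{bj+i}) − c) = M_{bj,b} + h(x_{bj}) − h(x_{bj+b})`,
`Scoring/ChainMartingaleFourthMoment.blockSum_eq_blockMartingale_add`), the tree's algebra
`ab · SE²_BM = (a/(a−1)) (V − W)` (`Scoring/BatchMeansSigmaHat.batchMeans_sigmaHat_eq`), ANY real `m`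
and ANY function `φ` (in the application: `m = π(q)` and `φ = φ_b` the conditional mean of the end
term), for `a ≥ 2`, `b ≥ 1` and every path `x`:
`√a (ab · SE²_BM − m) − (Σ_{j<a} (M_{bj,b}² − Σ_{i<b} q(x_{bj+i})))/(√a b)`
`= (Σ_{t<ab} (q(x_t) − m))/(√a b) + 2 (Σ_j M_{bj,b} h(x_{bj}))/(√a b)`
`  − 2 (Σ_j (M_{bj,b} h(x_{bj+b}) − φ(x_{bj})))/(√a b) − 2 (Σ_j φ(x_{bj}))/(√a b)`
`  + (Σ_j (h(x_{bj}) − h(x_{bj+b}))²)/(√a b) + (√a/(a−1)) V − (√a a/(a−1)) W`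
(`V = (Σ_j S_j²/b)/a`, `W = T²/(b a²)`, `T = Σ_{t<ab} (f(x_t) − c)`).  Each remainder is shown to be
negligible in `Scoring/BatchMeansCLTRemainder.lean`; the main term is asymptotically `N(0, 2σ⁴)` by
`Scoring/BatchMeansMartingaleCLT.lean`.

## Content

* `batchMeans_clt_algebra` — the scalar identity behind the decomposition;
* **`batchMeans_scaled_sub_martingalePart_eq`** — THE PATHWISE DECOMPOSITION above.

NOT CLAIMED: anything probabilistic.
-/

noncomputable section

namespace Summit.Ventures.LatticeQCDFlow.Scoring

open MeasureTheory ProbabilityTheory Filter Finset Preorder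
open scoped ENNReal Topology

variable {Ω : Type*} [MeasurableSpace Ω]

/-- The scalar identity: with `s² = a`, `A = B + 2D + E`,
`s((a/(a−1))(A/b/a − T²/(b a²)) − m) − (B − Q)/(s b)
 = (Q − a b m)/(s b) + 2D/(s b) + E/(s b) + (s/(a−1)) (A/b/a) − (s a/(a−1)) (T²/(b a²))`. -/
theorem batchMeans_clt_algebra (a b m s A B Q D E T : ℝ) (hs : s * s = a) (hs0 : s ≠ 0)
    (ha1 : a - 1 ≠ 0) (hb : b ≠ 0) (hA : A = B + 2 * D + E) :
    s * ((a / (a - 1)) * (A / b / a - T ^ 2 / (b * a ^ 2)) - m) - (B - Q) / (s * b)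
      = (Q - a * b * m) / (s * b) + 2 * D / (s * b) + E / (s * b)
        + s / (a - 1) * (A / b / a) - s * a / (a - 1) * (T ^ 2 / (b * a ^ 2)) := by
  have ha0 : a ≠ 0 := by rw [← hs]; exact mul_ne_zero hs0 hs0
  subst hA
  field_simp
  rw [← hs]
  ring

section Pathwise

variable (κ : Kernel Ω Ω) [IsMarkovKernel κ]

omit [IsMarkovKernel κ] in
/-- **THE PATHWISE DECOMPOSITION OF `√a (ab · SE²_BM − m)` AROUND THE CENTRED SQUARED BLOCK
MARTINGALES** (see the module docstring). -/
theorem batchMeans_scaled_sub_martingalePart_eq (f : Ω → ℝ) (c m : ℝ) {h : Ω → ℝ}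
    (hpois : ∀ y, h y - kop κ h y = f y - c) (φ : Ω → ℝ) {a b : ℕ} (ha : 2 ≤ a) (hb : b ≠ 0)
    (x : ℕ → Ω) :
    Real.sqrt a * (((b * a : ℕ) : ℝ) * replicaSEsq (fun j (x : ℕ → Ω) =>
        (∑ i ∈ Finset.range b, f (x (b * j + i))) / b) a x - m)
      - (∑ j ∈ Finset.range a, ((∑ r ∈ Finset.range b, (h (x (b * j + r + 1)) - kop κ h (x (b * j + r)))) ^ 2
          - ∑ i ∈ Finset.range b, (kop κ (fun y => h y ^ 2) (x (b * j + i)) - (kop κ h (x (b * j + i))) ^ 2))) / (Real.sqrt a * b)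
    = (∑ t ∈ Finset.range (b * a), ((kop κ (fun y => h y ^ 2) (x t) - (kop κ h (x t)) ^ 2) - m)) / (Real.sqrt a * b)
      + 2 * (∑ j ∈ Finset.range a, (∑ r ∈ Finset.range b, (h (x (b * j + r + 1)) - kop κ h (x (b * j + r)))) * h (x (b * j))) / (Real.sqrt a * b)
      - 2 * (∑ j ∈ Finset.range a, ((∑ r ∈ Finset.range b, (h (x (b * j + r + 1)) - kop κ h (x (b * j + r)))) * h (x (b * j + b)) - φ (x (b * j))))
          / (Real.sqrt a * b)
      - 2 * (∑ j ∈ Finset.range a, φ (x (b * j))) / (Real.sqrt a * b)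
      + (∑ j ∈ Finset.range a, (h (x (b * j)) - h (x (b * j + b))) ^ 2) / (Real.sqrt a * b)
      + Real.sqrt a / ((a : ℝ) - 1)
          * ((∑ j ∈ Finset.range a, (∑ i ∈ Finset.range b, (f (x (b * j + i)) - c)) ^ 2) / b / a)
      - Real.sqrt a * a / ((a : ℝ) - 1)
          * ((∑ t ∈ Finset.range (b * a), (f (x t) - c)) ^ 2 / ((b : ℝ) * (a : ℝ) ^ 2)) := by
  have haR : (0 : ℝ) < a := by exact_mod_cast (show 0 < a by omega)
  have ha1 : (a : ℝ) - 1 ≠ 0 := by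
    have : (2 : ℝ) ≤ a := by exact_mod_cast ha
    linarith
  have hbR : (b : ℝ) ≠ 0 := by exact_mod_cast hb
  have hs : Real.sqrt a * Real.sqrt a = a := Real.mul_self_sqrt haR.le
  have hs0 : Real.sqrt a ≠ 0 := (Real.sqrt_pos.2 haR).ne'
  -- the batch sums telescope: `S_j = M_j + R_j`
  have hS : ∀ j, ∑ i ∈ Finset.range b, (f (x (b * j + i)) - c)
      = (∑ r ∈ Finset.range b, (h (x (b * j + r + 1)) - kop κ h (x (b * j + r)))) + (h (x (b * j)) - h (x (b * j + b))) := by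
    intro j
    have := blockSum_eq_blockMartingale_add (kop κ) (fb := fun y => f y - c) hpois (b * j) b x
    rw [this]; ring
  -- the tree's algebra for `ab · SE²_BM`
  rw [batchMeans_sigmaHat_eq f c ha hb x]
  -- aggregate quantities
  set s := Real.sqrt a with hsdef
  set A := ∑ j ∈ Finset.range a, (∑ i ∈ Finset.range b, (f (x (b * j + i)) - c)) ^ 2 with hAdef
  set B := ∑ j ∈ Finset.range a, (∑ r ∈ Finset.range b, (h (x (b * j + r + 1)) - kop κ h (x (b * j + r)))) ^ 2 with hBdef
  set Q := ∑ j ∈ Finset.range a, ∑ i ∈ Finset.range b, (kop κ (fun y => h y ^ 2) (x (b * j + i)) - (kop κ h (x (b * j + i))) ^ 2) with hQdef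
  set D := ∑ j ∈ Finset.range a, (∑ r ∈ Finset.range b, (h (x (b * j + r + 1)) - kop κ h (x (b * j + r)))) * (h (x (b * j)) - h (x (b * j + b))) with hDdef
  set E := ∑ j ∈ Finset.range a, (h (x (b * j)) - h (x (b * j + b))) ^ 2 with hEdef
  set T := ∑ t ∈ Finset.range (b * a), (f (x t) - c) with hTdef
  have hAeq : A = B + 2 * D + E := by
    simp only [hAdef, hBdef, hDdef, hEdef, hS, Finset.mul_sum, ← Finset.sum_add_distrib]
    exact Finset.sum_congr rfl fun j _ => by ring
  have hsumdiv : (∑ j ∈ Finset.range a, (∑ i ∈ Finset.range b, (f (x (b * j + i)) - c)) ^ 2 / (b : ℝ))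
      = A / b := by rw [hAdef, Finset.sum_div]
  have hBQ : ∑ j ∈ Finset.range a, ((∑ r ∈ Finset.range b, (h (x (b * j + r + 1)) - kop κ h (x (b * j + r)))) ^ 2 - ∑ i ∈ Finset.range b, (kop κ (fun y => h y ^ 2) (x (b * j + i)) - (kop κ h (x (b * j + i))) ^ 2))
      = B - Q := by rw [hBdef, hQdef, ← Finset.sum_sub_distrib]
  have hQsum : ∑ t ∈ Finset.range (b * a), ((kop κ (fun y => h y ^ 2) (x t) - (kop κ h (x t)) ^ 2) - m) = Q - a * b * m := by
    rw [Finset.sum_sub_distrib, Finset.sum_const, Finset.card_range, nsmul_eq_mul, hQdef,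
      sum_range_mul_eq_sum_sum (fun t => (kop κ (fun y => h y ^ 2) (x t) - (kop κ h (x t)) ^ 2)) b a]
    push_cast; ring
  have hDsplit : 2 * (∑ j ∈ Finset.range a, (∑ r ∈ Finset.range b, (h (x (b * j + r + 1)) - kop κ h (x (b * j + r)))) * h (x (b * j))) / (s * b)
      - 2 * (∑ j ∈ Finset.range a, ((∑ r ∈ Finset.range b, (h (x (b * j + r + 1)) - kop κ h (x (b * j + r)))) * h (x (b * j + b)) - φ (x (b * j)))) / (s * b)
      - 2 * (∑ j ∈ Finset.range a, φ (x (b * j))) / (s * b) = 2 * D / (s * b) := by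
    rw [hDdef]
    have : ∑ j ∈ Finset.range a, (∑ r ∈ Finset.range b, (h (x (b * j + r + 1)) - kop κ h (x (b * j + r)))) * (h (x (b * j)) - h (x (b * j + b)))
        = ∑ j ∈ Finset.range a, (∑ r ∈ Finset.range b, (h (x (b * j + r + 1)) - kop κ h (x (b * j + r)))) * h (x (b * j))
          - ∑ j ∈ Finset.range a, ((∑ r ∈ Finset.range b, (h (x (b * j + r + 1)) - kop κ h (x (b * j + r)))) * h (x (b * j + b)) - φ (x (b * j)))
          - ∑ j ∈ Finset.range a, φ (x (b * j)) := by
      rw [← Finset.sum_sub_distrib, ← Finset.sum_sub_distrib]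
      exact Finset.sum_congr rfl fun j _ => by ring
    rw [this]; ring
  have key := batchMeans_clt_algebra (a : ℝ) b m s A B Q D E T hs hs0 ha1 hbR hAeq
  rw [hsumdiv, hBQ, hQsum]
  linear_combination key - hDsplit

end Pathwise

end Summit.Ventures.LatticeQCDFlow.Scoring

end
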